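import Literature.MathematicalPhysics.QuantumFieldTheory.Balaban1983to89.B9Ineq346L2Final
import Literature.MathematicalPhysics.QuantumFieldTheory.Balaban1983to89.B9Thm34GKernelUniformBlk

/-!
# `Balaban1983to89.B9Ineq346L2UniformBlk` — [Balaban1985BackgroundPropagators] THEOREM 3.4 p. 400 × THEOREM 3.3 p. 399 / THEOREM 3.1 (3.46)
# p. 398: THE `L²` MEMBERS (3.46)₁,₂,₃,₅ OF THE EXTENDED OPERATOR `G(U′U)` WITH THE CONSTANTS CHOSEN BEFORE THE LATTICE, THE THEOREM 3.2
# LETTERS `Q′(U), Q′*(U), C⁻¹ = (Q′G′²Q′*)⁻¹` ON A GENERAL FINITE BLOCK CARRIER `(P, blkP, rep)` — the append-only twin of r06's FILE 58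
# `B9Ineq346L2Uniform` §2 `thm34_G_l2_uniform` (its §1 `thm34_Gp_l2_uniform`, the `G′(U′U)` members, carries no `C`-letter and is not
# duplicated) — R-Ker-5 file K4, the endpoint of the `L²` cone of the `lit-balaban` r06 Blk series (consumer lineage `pub-ymgap` dag-n06-c:
# the `L2G` frame V3 at `node00-def-Y`'s letters, where the coarse carrier is `BlkY × ι`, not `𝔅`)

statement-level skeleton of published theorems with citation tags; proofs where landed; nothing here is a claim about the Yang–Mills mass gap

CITATION HEADER (lean-in-tree rule).  B9 = T. Bałaban, *Propagators for lattice gauge theories in a background field*, Commun. Math. Phys.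
**99** (1985) 389–434 [Balaban1985BackgroundPropagators] (held `paper:balaban1985-cmp99-background-propagators`; journal page = PDF page + 388):
Theorem 3.4 p. 400 [PDF 12] l. 7–10 «There exists a positive constant a₁ such that the operators G′(U), (Q′(U)G′²(U)Q′*(U))⁻¹, R(U), G(U) extend
to configurations U′U for α₁ ≦ a₁ as analytic functions of A. The extended operators satisfy all the inequalities of Theorems 3.1–3.3
correspondingly»; Theorem 3.1 (3.46) p. 398 [PDF 10] «Finally, we have the inequalities in L²-norms ‖hG′(U)λ‖, ‖h∇_UG′(U)λ‖, ‖hG′(U)∇*_Uλ‖,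
‖h∇_U∇_UG′(U)λ‖, ‖h∇_UG′(U)∇*_Uλ‖, ‖hG′(U)∇*_U∇*_Uλ‖ ≦ B₀[(Lʲη)², Lʲη, Lʲη, 1, 1, 1]|h|e^{−δ₀d(y,y′)}‖λ‖ for supp h ⊂ Δ(y), y ∈ Λ_j, supp λ ⊂
Δ(y′)»; the remark after (3.47) p. 398; p. 399 l. 1–3 («the constants … do not depend on the sequence {Ω_j}»); Theorem 3.3 p. 399 [PDF 11];
p. 403 l. 2–5; p. 407; the kernel pairing p. 393.  [4] = [Balaban1984PropagatorsII] (2.64)–(2.66) p. 234, Lemma 2.1 p. 234 [PDF 12], (2.51)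
p. 232.  Cell `lit-balaban`, seat r06 gen 68; rows B9.Thm3.4 × B9.Thm3.1 ((3.46) cell) × B9.Thm3.3 (cells only).

WHAT THIS FILE PROVES (one theorem; 0 `def`; 0 sorry; 0 new named facts; standard axioms).
* **`thm34_G_l2_uniform_blk`** — FILE 58 §2 `thm34_G_l2_uniform` VERBATIM in hypotheses and conclusion (`∃ a₁ > 0 ∃ B ≧ 0 ∀ (lattice, background,
  letters, Theorems 3.1–3.3 for U in block and kernel form, block volumes, v^{−1/2}-transfer) ∀ α₁ ≦ a₁ ∀ A kF sF … ∃ C⁻¹(U′U), G(U′U)` with the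
  (ii)/(iii) identities and the four `L²` members `‖hG(U′U)J‖₂ ≦ BH(Lʲη)²e^{−(δ₀/20)d(y,y′)}‖J‖₂`, `‖h∇_kG(U′U)J‖₂, ‖hG(U′U)∇_lJ‖₂ ≦
  BH(Lʲη)e^{−(δ₀/20)d}‖J‖₂`, `‖h∇_kG(U′U)∇_lJ‖₂ ≦ BHe^{−(δ₀/20)d}‖J‖₂`) except that the block carrier of the `C`-letters is a general finite
  type: binders `{P : Type} [Fintype P] [DecidableEq P] (blkP : P → g.Site) (rep : P → S × ι) (hrep : ∀ p, blk (rep p).1 = blkP p) (hinj :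
  Function.Injective rep)`, letters `Qc Qc' Fc : (S × ι → ℝ) →ₗ[ℝ] (P → ℝ)`, `Qcs Qcs' Fcs : (P → ℝ) →ₗ[ℝ] (S × ι → ℝ)`, `Linv Tinv :
  Module.End ℝ (P → ℝ)`, Theorem 3.2's (3.48) for `U` as `HasMajorant blkP Linv (B₁·(Lʲη)^{−4}·e^{−δ₀d})`.  Constant: `B = c_vΛ_v(1/20)B_{K3}`
  with `B_{K3}` the constant of `B9Thm34GKernelUniformBlk.thm34_G_kernel_uniform_blk` (the scalar file reads the same number from FILE 48's
  bundle).  The scalar statement is the case `P = 𝔅`, `blkP = id`, `rep` = FILE 17's section.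

PROOF.  FILE 58 §2's proof verbatim with ONE change of callee: the scalar proof takes `thm34_all_uniform` (FILE 48, the bundle of all Theorem
3.4 clauses) and uses ONLY its `G`-kernel conjuncts (`C⁻¹(U′U)`, `G(U′U)`, the (ii)/(iii) identities, the four kernel entries); here those
conjuncts are read from `B9Thm34GKernelUniformBlk.thm34_G_kernel_uniform_blk` (R-Ker-5 K3) directly — so the (3.24) letter `Δ′_a(U)` with
`hΔpGp`, `hGpΔp` stays in the statement (verbatim) but is not used by the proof; then FILE 39 §1 `l2_block_of_kernelBound_transfer` BY NAME on
each kernel entry, as printed («the local ones follow from the bound (3.85) and Lemma 2.1 [4]», p. 407; p. 398 remark).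

HONEST SCOPE / NOT CLAIMED.  As FILE 58 / FILE 39 (their module docstrings (a)–(f) apply verbatim: real-coordinate `ℓ²` norms; (3.46)₄,₆ not
covered; right differences are the letters `∇_l`).  Re-typing only: no new mathematics, no new named fact, nothing about continuum / OS / mass
gap / Clay; N06 of `pub-ymgap` is NOT discharged by this file.

RELATED IN THE TREE, NOT DUPLICATED: FILE 58 `B9Ineq346L2Uniform` (scalar carrier; §1 reused as is by consumers), FILE 39 `B9Ineq346L2Final`
(§1 device USED BY NAME), K3 `B9Thm34GKernelUniformBlk` — USED BY NAME; no existing module modified.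
-/

noncomputable section

namespace Literature.MathematicalPhysics.QuantumFieldTheory.Balaban1983to89.B9Ineq346L2UniformBlk

open NormedSpace Complex
open Literature.MathematicalPhysics.QuantumFieldTheory.Balaban1983to89
open Literature.MathematicalPhysics.QuantumFieldTheory.Balaban1983to89.B6RandomWalk (HasMajorant BlockSupp Triangle254 Ineq261)
open Literature.MathematicalPhysics.QuantumFieldTheory.Balaban1983to89.B6RandomWalkHom (HasMajorantHom)
open Literature.MathematicalPhysics.QuantumFieldTheory.Balaban1983to89.B6RandomWalkKernel (ker apply_eq_sum_ker HasKernelBound hasKernelBound_mono)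
open Literature.MathematicalPhysics.QuantumFieldTheory.Balaban1983to89.B6RandomWalkSection (secExt secRes secConj)
open Literature.MathematicalPhysics.QuantumFieldTheory.Balaban1983to89.B9Thm34Ext (toB6)
open Literature.MathematicalPhysics.QuantumFieldTheory.Balaban1983to89.B9Ineq347 (ScaleTransfer)
open Literature.MathematicalPhysics.QuantumFieldTheory.Balaban1983to89.B9Eq386Neumann (pTwo deltaA)
open Literature.MathematicalPhysics.QuantumFieldTheory.Balaban1983to89.B9Eq39Adjoint
open Literature.MathematicalPhysics.QuantumFieldTheory.Balaban1983to89.B9Eq369Small (Through)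
open Literature.MathematicalPhysics.QuantumFieldTheory.Balaban1983to89.B9Eq372Locality (stBonds)
open Literature.MathematicalPhysics.QuantumFieldTheory.Balaban1983to89.B9Eq352DivForm (tauF tauB)
open Literature.MathematicalPhysics.QuantumFieldTheory.Balaban1983to89.B9Eq352DivFormLetters
open Literature.MathematicalPhysics.QuantumFieldTheory.Balaban1983to89.B9Eq352GradLetters (diffLetter)
open Literature.MathematicalPhysics.QuantumFieldTheory.Balaban1983to89.B9Eq371GradLetters (bT bU)
open Literature.MathematicalPhysics.QuantumFieldTheory.Balaban1983to89.B9Eq372RemLetters (lapDDLetter)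
open Literature.MathematicalPhysics.QuantumFieldTheory.Balaban1983to89.B9Eq382V3Letters (dPrimeLetter)
open Literature.MathematicalPhysics.QuantumFieldTheory.Balaban1983to89.B9Eq376POneLetters (conjHom gradLin divLin)
open Literature.MathematicalPhysics.QuantumFieldTheory.Balaban1983to89.B9Eq360Vprime (gPrimeExtEnd)
open Literature.MathematicalPhysics.QuantumFieldTheory.Balaban1983to89.B9Eq360VprimeLetters (vPrimeConc)
open Literature.MathematicalPhysics.QuantumFieldTheory.Balaban1983to89.B9Thm34GKernelUniformBlk (thm34_G_kernel_uniform_blk)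
open Literature.MathematicalPhysics.QuantumFieldTheory.Balaban1983to89.B9Ineq346L2Final (l2_block_of_kernelBound_transfer)

section L2U2

variable {𝔸 : Type*} [NormedRing 𝔸] [NormedAlgebra ℂ 𝔸] [CompleteSpace 𝔸] {ι : Type} [Fintype ι]
variable (b : Module.Basis ι ℝ 𝔸) (κ : Type) [Fintype κ] [LinearOrder κ]

set_option maxHeartbeats 1600000 in
/-- **THEOREM 3.4 × THEOREM 3.3: THE `L²` MEMBERS (3.46)₁,₂,₃,₅ FOR THE `G(U′U)` OF FILE 28/48, THE CONSTANTS CHOSEN BEFORE THE LATTICE, THE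
THEOREM 3.2 LETTERS `Q′(U), Q′*(U), C⁻¹` ON A GENERAL BLOCK CARRIER `(P, blkP, rep)`**
(Theorem 3.3 p. 399 «with G′(U) replaced by G(U) and λ replaced by a function J defined at bonds»; (3.46) p. 398; for `U′U` by Theorem 3.4
p. 400 and p. 407; «the constants … do not depend on the sequence {Ω_j}», p. 399): `∃ a₁ > 0 ∃ B ≧ 0 ∀ (lattice 𝔅 = g, background U, data,
Theorems 3.1–3.3 for U as FILE 28/48, block volumes of the bond carrier, [4] Lemma 2.1 for v^{−1/2}) ∀ α₁ ≦ a₁ ∀ A …` (FILE 28's premises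
verbatim) `∃ C⁻¹(U′U), G(U′U)` — FILE 28's pair ((ii)/(iii) defining identities re-exported) — with, for all `y, y′`, `h` (`|h| ≦ H`, `supp h ⊂
Δ(y)`), `J` (`supp J ⊂ Δ(y′)`): `‖hG(U′U)J‖₂ ≦ BH(Lʲη)²e^{−(δ₀/20)d(y,y′)}‖J‖₂`, `‖h∇_kG(U′U)J‖₂, ‖hG(U′U)∇_lJ‖₂ ≦ BH(Lʲη)e^{−(δ₀/20)d}‖J‖₂`,
`‖h∇_kG(U′U)∇_lJ‖₂ ≦ BHe^{−(δ₀/20)d}‖J‖₂` — FILE 39 `thm34_G_l2_final` verbatim, re-quantified; `c_v`, `Λ_v(·)` inputs fixed before the lattice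
(`hcv`, `hΛvf`); `B = c_vΛ_v(1/20)B_{K3}` (`B_{K3}` = the constant of `B9Thm34GKernelUniformBlk.thm34_G_kernel_uniform_blk`); the scalar
statement `B9Ineq346L2Uniform.thm34_G_l2_uniform` is the case `P = 𝔅`, `blkP = id`.
[cite: Balaban1985BackgroundPropagators, Thm 3.4 p.400 + p.399 + Thm 3.3 p.399 + Thm 3.1 (3.42)/(3.46) pp.397–398 + p.398 remark + p.393 + (3.84)–(3.86) p.407; Balaban1984PropagatorsII, (2.64)–(2.66) p.234 + Lemma 2.1 p.234] -/
theorem thm34_G_l2_uniform_blk [DecidableEq ι] (d : ℕ)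
    (δ₀ B₀ κQ BG B₁ cF Cq a₀ C₀ d₀ M₂ κQb cFb abar : ℝ) (Λf Λvf : ℝ → ℝ) (cv : ℝ)
    (hB₀ : 0 ≤ B₀) (hκQ : 0 < κQ) (hBG : 0 < BG) (hB₁ : 0 < B₁) (hcF : 0 < cF) (hCq : 0 ≤ Cq) (ha₀ : 0 ≤ a₀) (hC₀ : 0 ≤ C₀)
    (hM₂ : 0 ≤ M₂) (hδ₀ : 0 < δ₀) (hκQb : 0 ≤ κQb) (hcFb : 0 ≤ cFb) (habar : 0 ≤ abar) (hΛf : ∀ α : ℝ, 0 < α → 1 ≤ Λf α)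
    -- NEW AT THE THEOREM LEVEL (L² files): [4] Lemma 2.1 for the block-volume weight `v^{−1/2}` read from `Λvf`, the sign of the pairing-volume constant
    (hΛvf : ∀ α : ℝ, 0 < α → 1 ≤ Λvf α) (hcv : 0 ≤ cv)
    (hrepr : ∀ (v : 𝔸) (i : ι), |b.repr v i| ≤ M₂ * ‖v‖) :
    ∃ a₁ : ℝ, 0 < a₁ ∧ ∃ B : ℝ, 0 ≤ B ∧
    ∀ {S : Type} [Fintype S] [DecidableEq S] (T : κ → Equiv.Perm S) (U : κ → S → 𝔸ˣ)
      {g : B9.Geometry} [Fintype g.Site] [DecidableEq g.Site] [Nonempty g.Site] {Rr : ℝ} {H : Prop} (blk : S → g.Site)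
      (kQ : g.Site → S → 𝔸 →L[ℝ] 𝔸) (sQ : S → 𝔸 →L[ℝ] 𝔸) (cfun w : g.Site → ℝ)
    -- the multiscale geometry 𝔅 (p. 393, [4] (2.1)–(2.4)) and its axioms
    (hdnn : ∀ a a' : g.Site, 0 ≤ g.dist a a') (htri : Triangle254 (toB6 g Rr H)) (hrefl : ∀ y : g.Site, g.dist y y = 0)
    (hsym : ∀ y y' : g.Site, g.dist y y' = g.dist y' y) (hlen : ∀ y : g.Site, 0 < g.len y) (hlenη : ∀ y : g.Site, g.eta ≤ g.len y)
    (hη : 0 < g.eta) (hL : 1 ≤ g.L)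
    -- [4] Lemma 2.1 (2.61) at the rate `δ₀`, «for every 0 < α < 1»
    (h261 : ∀ α : ℝ, 0 < α → α < 1 → Ineq261 d (toB6 g Rr H) δ₀ α)
    -- p. 398: «Using Lemma 2.1 in [4] we may replace the factor (Lʲη)^α by (Lʲη)^β(L^{j′}η)^γ with β + γ = α» — for every exponent, one
    -- constant `Λ(α) ≧ 1` for the six weights `(Lʲη)^{1,2,−1,−2,−4}` (natural and real powers)
      (hST : ∀ α : ℝ, 0 < α → ScaleTransfer g δ₀ α (Λf α) (fun a => g.len a) ∧ ScaleTransfer g δ₀ α (Λf α) (fun a => g.len a ^ 2) ∧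
        ScaleTransfer g δ₀ α (Λf α) (fun a => (g.len a)⁻¹) ∧ ScaleTransfer g δ₀ α (Λf α) (fun a => (g.len a ^ 2)⁻¹) ∧
        ScaleTransfer g δ₀ α (Λf α) (fun a => (g.len a ^ 4)⁻¹) ∧ ScaleTransfer g δ₀ α (Λf α) (fun y => g.len y ^ (-(4 : ℝ))))
    -- real coordinates of `𝔸`, commuting translations, unitary-type background
    (hT : ∀ (μ ν : κ) (x : S), T μ (T ν x) = T ν (T μ x))
    (hU1 : ∀ m z, ‖((U m z : 𝔸ˣ) : 𝔸)‖ ≤ 1 ∧ ‖(((U m z)⁻¹ : 𝔸ˣ) : 𝔸)‖ ≤ 1)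
    -- (3.35) on the plaquettes through each bond, at that bond's block scale; stencil geometry at range `d₀`
    (h35 : ∀ μ x m n y, Through T μ x m n y → ‖(plaqU T U m n y : 𝔸) - 1‖ ≤ C₀ * ((g.L ^ g.scale (blk x))⁻¹) ^ 2)
    (hd₀B : ∀ μ x, g.dist (blk x) (blk ((T μ).symm x)) ≤ d₀) (hd₀F : ∀ μ x, g.dist (blk x) (blk (T μ x)) ≤ d₀)
    (hd₀FB : ∀ μ ν x, g.dist (blk x) (blk ((T ν).symm (T μ x))) ≤ d₀)
    (hd₀st : ∀ μ x (q : κ × S), q ∈ stBonds T μ x → g.dist (blk x) (blk q.2) ≤ d₀)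
    (hd₀loc : ∀ μ x (q : κ × S), q ∈ B9Eq375Locality.locBondsA' T μ x → g.dist (blk x) (blk q.2) ≤ d₀)
    (hd₀0 : ∀ y : g.Site, g.dist y y ≤ d₀)
    -- the `A`-independent data of the concrete `V′(A)` of (3.60): (3.19) kernels/multipliers and the `a`-weights of (3.24)
    (hw : ∀ y, 0 ≤ w y) (hcard : ∀ y, ((B9Eq360Vprime.block blk y).card : ℝ) * w y ≤ 1)
    (hkQ : ∀ y x, blk x = y → ‖kQ y x‖ ≤ w y) (hsQ : ∀ x, ‖sQ x‖ ≤ 1) (hcfun : ∀ y, |cfun y| ≤ a₀ * (g.len y ^ 2)⁻¹)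
    -- THEOREM 3.1 for `G′(U)`: (3.42)₁,₂,₃ at the rate `δ₀`
    {Gp : Module.End ℝ (S × ι → ℝ)}
    (h342_1 : HasMajorant (g := toB6 g Rr H) (fun p : S × ι => blk p.1) Gp
      (fun a a' => BG * g.len a ^ 2 * Real.exp (-(δ₀ * g.dist a a'))))
    (h342_2 : ∀ k : κ ⊕ κ, HasMajorant (g := toB6 g Rr H) (fun p : S × ι => blk p.1)
      (conj b (diffLetter T U ((g.eta : ℂ)⁻¹) k) * Gp) (fun a a' => BG * g.len a * Real.exp (-(δ₀ * g.dist a a'))))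
    (h342_3 : ∀ k : κ ⊕ κ, HasMajorant (g := toB6 g Rr H) (fun p : S × ι => blk p.1)
      (Gp * conj b (diffLetter T U ((g.eta : ℂ)⁻¹) k)) (fun a a' => BG * g.len a * Real.exp (-(δ₀ * g.dist a a'))))
    -- (3.24): `G′(U) = (Δ′_a(U))⁻¹` for the letter `Δ′_a(U)`
    {Δp : Module.End ℝ (S × ι → ℝ)} (hΔpGp : Δp * Gp = 1) (hGpΔp : Gp * Δp = 1)
    -- THE BLOCK CARRIER OF THE `C`-LETTERS: any finite type `P` with block map `blkP : P → 𝔅` and an injective, block-compatible section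
    -- `rep : P → S × ι` (FILE 17 `B6RandomWalkSection`); the (3.19) letters `Q′(U)`, `Q′*(U)` typed between the sites and `P`, block-local
    {P : Type} [Fintype P] [DecidableEq P] (blkP : P → g.Site) (rep : P → S × ι) (hrep : ∀ p : P, blk (rep p).1 = blkP p)
    (hinj : Function.Injective rep)
    {Qc : (S × ι → ℝ) →ₗ[ℝ] (P → ℝ)} {Qcs : (P → ℝ) →ₗ[ℝ] (S × ι → ℝ)} {Linv : Module.End ℝ (P → ℝ)}
    (hQc : HasMajorantHom (g := toB6 g Rr H) (fun p : S × ι => blk p.1) blkP Qc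
      (fun a a' : g.Site => κQ * (if a = a' then (1 : ℝ) else 0)))
    (hQcs : HasMajorantHom (g := toB6 g Rr H) blkP (fun p : S × ι => blk p.1) Qcs
      (fun a a' : g.Site => κQ * (if a = a' then (1 : ℝ) else 0)))
    -- THEOREM 3.2 for `U`: (3.21) `C⁻¹ = (Q′G′²Q′*)⁻¹` exists (`hLinv`, two-sided on `P → ℝ`) with (3.48) as a [4] (2.51) BLOCK MAJORANT over
    -- `blkP` at the rate `δ₀` (r06 R-Ker-1 `B9Thm34InvBlk.thm34_Cinv_uniform_blk` delivers this currency; `hasMajorant_blk_iff` = ℓ¹ fibre rows)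
    (hLinv : (Qc ∘ₗ (Gp * Gp) ∘ₗ Qcs) * Linv = 1)
    (h348 : HasMajorant (g := toB6 g Rr H) blkP Linv
      (fun a a' => B₁ * g.len a ^ (-(4 : ℝ)) * Real.exp (-(δ₀ * g.dist a a'))))
    -- the (3.15) bond letters `Q(U)`, `Q*(U)` and the weight letter `a` of (3.24)/(3.26), with their majorants
    {G Qs Q a : Module.End ℝ ((κ × S) × ι → ℝ)}
    (hQb : HasMajorant (g := toB6 g Rr H) (fun q : (κ × S) × ι => blk q.1.2) Q (fun a a' => κQb * Real.exp (-(δ₀ * g.dist a a'))))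
    (hQsb : HasMajorant (g := toB6 g Rr H) (fun q : (κ × S) × ι => blk q.1.2) Qs (fun a a' => κQb * Real.exp (-(δ₀ * g.dist a a'))))
    (ha324 : HasMajorant (g := toB6 g Rr H) (fun q : (κ × S) × ι => blk q.1.2) a
      (fun a a' : g.Site => if a = a' then abar * (g.len a ^ 2)⁻¹ else 0))
    -- THEOREM 3.3 for `G(U)`: two-sided inverse of the concrete `Δ_a(U)` and its (3.42)-entries at the rate `δ₀`
    (hΔG : deltaA (conj b (lapDDLetter T ((g.eta : ℂ)⁻¹) U)) (conj b (dPrimeLetter T U g.eta))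
      (conjHom b (gradLin T ((g.eta : ℂ)⁻¹) U) ∘ₗ (1 - (Gp ∘ₗ Qcs ∘ₗ Linv ∘ₗ Qc ∘ₗ Gp)) ∘ₗ conjHom b (divLin T ((g.eta : ℂ)⁻¹) U)) Qs a Q * G = 1)
    (hGΔ : G * deltaA (conj b (lapDDLetter T ((g.eta : ℂ)⁻¹) U)) (conj b (dPrimeLetter T U g.eta))
      (conjHom b (gradLin T ((g.eta : ℂ)⁻¹) U) ∘ₗ (1 - (Gp ∘ₗ Qcs ∘ₗ Linv ∘ₗ Qc ∘ₗ Gp)) ∘ₗ conjHom b (divLin T ((g.eta : ℂ)⁻¹) U)) Qs a Q = 1)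
    (hG : HasMajorant (g := toB6 g Rr H) (fun q : (κ × S) × ι => blk q.1.2) G
      (fun a a' => B₀ * g.len a ^ 2 * Real.exp (-(δ₀ * g.dist a a'))))
    (hDG : ∀ k : κ ⊕ κ, HasMajorant (g := toB6 g Rr H) (fun q : (κ × S) × ι => blk q.1.2)
      (conj b (diffLetter (bT T) (bU U) ((g.eta : ℂ)⁻¹) k) * G) (fun a a' => B₀ * g.len a * Real.exp (-(δ₀ * g.dist a a'))))
    (hGD : ∀ k : κ ⊕ κ, HasMajorant (g := toB6 g Rr H) (fun q : (κ × S) × ι => blk q.1.2)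
      (G * conj b (diffLetter (bT T) (bU U) ((g.eta : ℂ)⁻¹) k)) (fun a a' => B₀ * g.len a * Real.exp (-(δ₀ * g.dist a a'))))
    -- (kernel form): Theorem 3.3's (3.42)₁,₂,₃,₄ for `G(U)` as PRINTED KERNEL BOUNDS (pairing weight `c = η^d`, volume weight `v(y′) = (L^j′ η)^d`)
    {v : g.Site → ℝ} (hv : ∀ y, 0 < v y) {c : ℝ} (hc : 0 < c)
    (hGk : HasKernelBound (g := toB6 g Rr H) (fun q : (κ × S) × ι => blk q.1.2) v c G
      (fun a a' => B₀ * g.len a ^ 2 * Real.exp (-(δ₀ * g.dist a a'))))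
    (hDGk : ∀ k : κ ⊕ κ, HasKernelBound (g := toB6 g Rr H) (fun q : (κ × S) × ι => blk q.1.2) v c
      (conj b (diffLetter (bT T) (bU U) ((g.eta : ℂ)⁻¹) k) * G) (fun a a' => B₀ * g.len a * Real.exp (-(δ₀ * g.dist a a'))))
    (hGDk : ∀ l : κ ⊕ κ, HasKernelBound (g := toB6 g Rr H) (fun q : (κ × S) × ι => blk q.1.2) v c
      (G * conj b (diffLetter (bT T) (bU U) ((g.eta : ℂ)⁻¹) l)) (fun a a' => B₀ * g.len a * Real.exp (-(δ₀ * g.dist a a'))))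
    (hDGDk : ∀ k l : κ ⊕ κ, HasKernelBound (g := toB6 g Rr H) (fun q : (κ × S) × ι => blk q.1.2) v c
      (conj b (diffLetter (bT T) (bU U) ((g.eta : ℂ)⁻¹) k) * G * conj b (diffLetter (bT T) (bU U) ((g.eta : ℂ)⁻¹) l)) (fun a a' => B₀ * Real.exp (-(δ₀ * g.dist a a'))))
    -- NEW: the block volumes of the bond carrier in the kernel pairing (p. 393) and [4] Lemma 2.1 for the block-volume weight `v^{−1/2}` (p. 398 remark)
    (hvol : ∀ y : g.Site, c * ((Finset.univ.filter (fun q : (κ × S) × ι => blk q.1.2 = y)).card : ℝ) ≤ cv * v y)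
    (hSTv : ∀ α : ℝ, 0 < α → ScaleTransfer g δ₀ α (Λvf α) (fun y => (Real.sqrt (v y))⁻¹)),
    ∀ (α₁ : ℝ), 0 ≤ α₁ → α₁ ≤ a₁ →
    -- the exponent field `A` in the domain (3.37), read blockwise in the shapes of FILES 1–19, and the `A`-dependent (3.59) data `kF`, `sF`
    ∀ (A : κ → S → 𝔸) (kF : g.Site → S → 𝔸 →L[ℝ] 𝔸) (sF : S → 𝔸 →L[ℝ] 𝔸),
      (∀ y x, blk x = y → ‖kF y x‖ ≤ Cq * α₁ * w y) → (∀ x, ‖sF x‖ ≤ Cq * α₁) →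
      (∀ ν k x, ‖((g.eta : ℂ)⁻¹) • covDstar T U ν (A k) x‖ ≤ α₁ * (g.len (blk x) ^ 2)⁻¹) →
      (∀ μ ν x, ‖((g.eta : ℂ)⁻¹) • covD T U μ (A ν) x‖ ≤ α₁ * (g.len (blk x) ^ 2)⁻¹) →
      (∀ μ ν x, ‖((g.eta : ℂ)⁻¹) • covDstar T U ν (A ν) (T μ x)‖ ≤ α₁ * (g.len (blk x) ^ 2)⁻¹) →
      (∀ μ x, ‖((g.eta : ℂ)⁻¹) • covDstar T U μ (tauB T U μ (A μ)) x‖ ≤ α₁ * (g.len (blk x) ^ 2)⁻¹) →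
      (∀ μ ν k x, ‖((g.eta : ℂ)⁻¹) • covD T U μ (A k) ((T ν).symm x)‖ ≤ α₁ * (g.len (blk x) ^ 2)⁻¹) →
      (∀ k x, ‖A k x‖ ≤ α₁ * (g.len (blk x))⁻¹) → (∀ ν k x, ‖tauB T U ν (A k) x‖ ≤ α₁ * (g.len (blk x))⁻¹) →
      (∀ μ k x, ‖tauF T U μ (A k) x‖ ≤ α₁ * (g.len (blk x))⁻¹) →
      (∀ k μ ν x, ‖A k ((T ν).symm (T μ x))‖ ≤ α₁ * (g.len (blk x))⁻¹) →
      (∀ μ x m z, (m, z) ∈ stBonds T μ x → ‖A m z‖ ≤ α₁ * (g.len (blk x))⁻¹) →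
      (∀ μ x m z, (m, z) ∈ B9Eq375Locality.locBondsA T μ x → ‖A m z‖ ≤ α₁ * (g.len (blk x))⁻¹) →
      (∀ μ x m n y, Through T μ x m n y →
        ‖covD T U m (A n) y‖ ≤ g.eta * (α₁ * ((g.len (blk x))⁻¹) ^ 2) ∧ ‖covD T U n (A m) y‖ ≤ g.eta * (α₁ * ((g.len (blk x))⁻¹) ^ 2)) →
    -- the (3.57)/(3.59) letters `F′₂(A)`, `F′₂*(A)` (block-local, size `c_F α₁`)
    ∀ {Qc' Fc : (S × ι → ℝ) →ₗ[ℝ] (P → ℝ)} {Qcs' Fcs : (P → ℝ) →ₗ[ℝ] (S × ι → ℝ)},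
      Qc' = Qc + Fc → Qcs' = Qcs + Fcs →
      HasMajorantHom (g := toB6 g Rr H) (fun p : S × ι => blk p.1) blkP Fc
        (fun a a' : g.Site => cF * α₁ * (if a = a' then (1 : ℝ) else 0)) →
      HasMajorantHom (g := toB6 g Rr H) blkP (fun p : S × ι => blk p.1) Fcs
        (fun a a' : g.Site => cF * α₁ * (if a = a' then (1 : ℝ) else 0)) →
    -- the (3.80)–(3.81) letters `F₂(A)`, `F₂*(A)` («|F₂(A)|, |F₂*(A)| ≦ O(1)α₁»), `P₂(A)` of (3.82)
    ∀ {P₂ Qs' Q' F₂ F₂s : Module.End ℝ ((κ × S) × ι → ℝ)},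
      Q' = Q + F₂ → Qs' = Qs + F₂s → P₂ = pTwo Qs Q F₂ F₂s a →
      HasMajorant (g := toB6 g Rr H) (fun q : (κ × S) × ι => blk q.1.2) F₂ (fun a a' => cFb * α₁ * Real.exp (-(δ₀ * g.dist a a'))) →
      HasMajorant (g := toB6 g Rr H) (fun q : (κ × S) × ι => blk q.1.2) F₂s (fun a a' => cFb * α₁ * Real.exp (-(δ₀ * g.dist a a'))) →
    ∃ (Tinv : Module.End ℝ (P → ℝ)) (GExt : Module.End ℝ ((κ × S) × ι → ℝ)),
      -- (ii) `C⁻¹(U′U)` = THE two-sided inverse of `Q′(U′U)G′²(U′U)Q′*(U′U)` (FILE 28, re-exported)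
      Tinv * (Qc' ∘ₗ ((gPrimeExtEnd Gp (conj b (vPrimeConc T U g.eta A blk kQ kF sQ sF cfun) * Gp)) * (gPrimeExtEnd Gp (conj b (vPrimeConc T U g.eta A blk kQ kF sQ sF cfun) * Gp))) ∘ₗ Qcs') = 1 ∧
      (Qc' ∘ₗ ((gPrimeExtEnd Gp (conj b (vPrimeConc T U g.eta A blk kQ kF sQ sF cfun) * Gp)) * (gPrimeExtEnd Gp (conj b (vPrimeConc T U g.eta A blk kQ kF sQ sF cfun) * Gp))) ∘ₗ Qcs') * Tinv = 1 ∧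
      -- (iii) `G(U′U)` = THE two-sided inverse of the concrete `Δ_a(U′U)` built with this `C⁻¹(U′U)` (FILE 28, re-exported)
      deltaA (conj b (lapDDLetter T ((g.eta : ℂ)⁻¹) (prodCfg U g.eta A)))
          (conj b (dPrimeLetter T (prodCfg U g.eta A) g.eta))
          (conjHom b (gradLin T ((g.eta : ℂ)⁻¹) (prodCfg U g.eta A)) ∘ₗ (1 - ((Gp ∘ₗ Qcs ∘ₗ Linv ∘ₗ Qc ∘ₗ Gp) + (B9Eq360Vprime.pPrime Gp (gPrimeExtEnd Gp (conj b (vPrimeConc T U g.eta A blk kQ kF sQ sF cfun) * Gp)) (Qcs ∘ₗ secRes rep) (Qcs' ∘ₗ secRes rep) (secConj rep Linv) (secConj rep Tinv) (secExt rep ∘ₗ Qc) (secExt rep ∘ₗ Qc'))))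
            ∘ₗ conjHom b (divLin T ((g.eta : ℂ)⁻¹) (prodCfg U g.eta A))) Qs' a Q' * GExt = 1 ∧
      GExt *
      deltaA (conj b (lapDDLetter T ((g.eta : ℂ)⁻¹) (prodCfg U g.eta A)))
          (conj b (dPrimeLetter T (prodCfg U g.eta A) g.eta))
          (conjHom b (gradLin T ((g.eta : ℂ)⁻¹) (prodCfg U g.eta A)) ∘ₗ (1 - ((Gp ∘ₗ Qcs ∘ₗ Linv ∘ₗ Qc ∘ₗ Gp) + (B9Eq360Vprime.pPrime Gp (gPrimeExtEnd Gp (conj b (vPrimeConc T U g.eta A blk kQ kF sQ sF cfun) * Gp)) (Qcs ∘ₗ secRes rep) (Qcs' ∘ₗ secRes rep) (secConj rep Linv) (secConj rep Tinv) (secExt rep ∘ₗ Qc) (secExt rep ∘ₗ Qc'))))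
            ∘ₗ conjHom b (divLin T ((g.eta : ℂ)⁻¹) (prodCfg U g.eta A))) Qs' a Q' = 1 ∧
      -- (vii) NEW: the `L²` members (3.46)₁,₂,₃,₅ of Theorem 3.3 for THIS `G(U′U)`
      (∀ (y y' : g.Site) (hf μ : (κ × S) × ι → ℝ) (Hh : ℝ), 0 ≤ Hh → (∀ x, |hf x| ≤ Hh) → (∀ x, blk x.1.2 ≠ y → hf x = 0) →
        (∀ x, blk x.1.2 ≠ y' → μ x = 0) →
        Real.sqrt (∑ x, (hf x * GExt μ x) ^ 2) ≤ B * Hh * g.len y ^ 2 * Real.exp (-(1 / 20 * δ₀ * g.dist y y')) * Real.sqrt (∑ x, μ x ^ 2) ∧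
        (∀ k : κ ⊕ κ, Real.sqrt (∑ x, (hf x * ((conj b (diffLetter (bT T) (bU U) ((g.eta : ℂ)⁻¹) k)) * GExt) μ x) ^ 2) ≤ B * Hh * g.len y * Real.exp (-(1 / 20 * δ₀ * g.dist y y')) * Real.sqrt (∑ x, μ x ^ 2)) ∧
        (∀ l : κ ⊕ κ, Real.sqrt (∑ x, (hf x * (GExt * (conj b (diffLetter (bT T) (bU U) ((g.eta : ℂ)⁻¹) l))) μ x) ^ 2) ≤ B * Hh * g.len y * Real.exp (-(1 / 20 * δ₀ * g.dist y y')) * Real.sqrt (∑ x, μ x ^ 2)) ∧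
        (∀ k l : κ ⊕ κ, Real.sqrt (∑ x, (hf x * ((conj b (diffLetter (bT T) (bU U) ((g.eta : ℂ)⁻¹) k)) * GExt * (conj b (diffLetter (bT T) (bU U) ((g.eta : ℂ)⁻¹) l))) μ x) ^ 2) ≤ B * Hh * Real.exp (-(1 / 20 * δ₀ * g.dist y y')) * Real.sqrt (∑ x, μ x ^ 2))) := by
  classical
  -- the scale-transfer constants of the chain, READ FROM THE GIVEN FUNCTION `Λvf` (lattice-free)
  have hΛ1 : 1 ≤ Λvf (1 / 20) := hΛvf _ (by norm_num)
  -- K3 (the `G`-kernel clause on the block carrier) in place of FILE 48's bundle: the scalar proof uses only these conjuncts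
  obtain ⟨a₁, ha₁, B', hB', H28⟩ := thm34_G_kernel_uniform_blk b κ d δ₀ B₀ κQ BG B₁ cF Cq a₀ C₀ d₀ M₂ κQb cFb abar Λf hB₀ hκQ hBG hB₁ hcF hCq ha₀
    hC₀ hM₂ hδ₀ hκQb hcFb habar hΛf hrepr
  refine ⟨a₁, ha₁, cv * (Λvf (1 / 20)) * B', mul_nonneg (mul_nonneg hcv (zero_le_one.trans hΛ1)) hB', ?_⟩
  -- NOW the lattice, the background, the data, the Theorems-for-`U` inputs (block and kernel members); then `α₁`, `A` and the `A`-letters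
  intro S _ _ T U g _ _ _ Rr H blk kQ sQ cfun w hdnn htri hrefl hsym hlen hlenη hη hL h261 hST hT hU1 h35 hd₀B hd₀F hd₀FB hd₀st hd₀loc hd₀0 hw hcard
    hkQ hsQ hcfun Gp h342_1 h342_2 h342_3 Δp _ _ P _ _ blkP rep hrep hinj Qc Qcs Linv hQc hQcs hLinv h348 G Qs Q a hQb hQsb ha324 hΔG hGΔ hG hDG hGD v hv c
    hc hGk hDGk hGDk hDGDk hvol hSTv α₁ hα₁0 hα₁1 A kF sF hkF hsF h337B h337F h337B' h337Bτ h337FB hA hAτB hAτF hAFB hAst hAloc hdAst Qc' Fc Qcs'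
    Fcs h357 h357s hFc hFcs P₂ Qs' Q' F₂ F₂s h380 h380s hP₂def hF₂ hF₂s
  replace H28 := H28 T U blk kQ sQ cfun w hdnn htri hrefl hsym hlen hlenη hη hL h261 hST hT hU1 h35 hd₀B hd₀F hd₀FB hd₀st hd₀loc hd₀0 hw hcard hkQ
    hsQ hcfun h342_1 h342_2 h342_3 blkP rep hrep hinj hQc hQcs hLinv h348 hQb hQsb ha324 hΔG hGΔ hG hDG hGD hv hc hGk hDGk hGDk hDGDk
  have hTv := hSTv (1 / 20) (by norm_num)
  obtain ⟨Tinv, GExt, e1, e2, e3, e4, -, -, K1, K2, K3, K4⟩ := H28 α₁ hα₁0 hα₁1 A kF sF hkF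
    hsF h337B h337F h337B' h337Bτ h337FB hA hAτB hAτF hAFB hAst hAloc hdAst h357 h357s hFc hFcs h380 h380s hP₂def hF₂ hF₂s
  have hρ' : 1 / 20 * δ₀ + 1 / 20 * δ₀ ≤ 1 / 10 * δ₀ := by linarith only [hδ₀]
  have hw2 : ∀ a : g.Site, 0 ≤ g.len a ^ 2 := fun a => sq_nonneg _
  have hw1 : ∀ a : g.Site, 0 ≤ g.len a := fun a => (hlen a).le
  have hw0 : ∀ _a : g.Site, (0 : ℝ) ≤ 1 := fun _ => zero_le_one
  refine ⟨Tinv, GExt, e1, e2, e3, e4, ?_⟩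
  intro y y' hf μ Hh hHh hh hh0 hμ0
  refine ⟨?_, ?_, ?_, ?_⟩
  · simpa only using l2_block_of_kernelBound_transfer (R := Rr) (H := H) (fun q : (κ × S) × ι => blk q.1.2) hv hc hvol hB' hρ' hdnn hTv
      (w := fun a => g.len a ^ 2) hw2 K1 y y' hf μ Hh hHh hh hh0 hμ0
  · intro k
    simpa only using l2_block_of_kernelBound_transfer (R := Rr) (H := H) (fun q : (κ × S) × ι => blk q.1.2) hv hc hvol hB' hρ' hdnn hTv
      (w := fun a => g.len a) hw1 (K2 k) y y' hf μ Hh hHh hh hh0 hμ0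
  · intro l
    simpa only using l2_block_of_kernelBound_transfer (R := Rr) (H := H) (fun q : (κ × S) × ι => blk q.1.2) hv hc hvol hB' hρ' hdnn hTv
      (w := fun a => g.len a) hw1 (K3 l) y y' hf μ Hh hHh hh hh0 hμ0
  · intro k l
    have K4' := hasKernelBound_mono (g := toB6 g Rr H) (fun q : (κ × S) × ι => blk q.1.2) hv (K4 k l)
      (K' := fun a a' => B' * (1 : ℝ) * Real.exp (-(1 / 10 * δ₀ * g.dist a a'))) fun a a' => le_of_eq (by ring)
    simpa only [mul_one] using l2_block_of_kernelBound_transfer (R := Rr) (H := H) (fun q : (κ × S) × ι => blk q.1.2) hv hc hvol hB' hρ' hdnn hTv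
      (w := fun _ => (1 : ℝ)) hw0 K4' y y' hf μ Hh hHh hh hh0 hμ0

end L2U2

end Literature.MathematicalPhysics.QuantumFieldTheory.Balaban1983to89.B9Ineq346L2UniformBlk

end
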